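import Summits.QuantumAdvantage.QuantumAdvantage.Theorems.CubicForrelationSignedExactCubicForrelationNotPrBPPStubCubeBlockSumsCube

/-!
# Crux `CubicForrelation.SignedExactCubicForrelationNotPrBPP` (stmt-QuantumAdvantage-13932), line `dual-pingpong-frame`
# (classify-then-count cut): stub `stub_cubeBlockSums` (H4) — the event at ANY block; statistics at a confined pair

Support file 3/4 (`--supports stmt-QuantumAdvantage-13932`). W1's event calculus for the cube template
(`…StubCubeKernelStatsLemmas2.lean`: on the event "block `0` of every probe's `y''`-part vanishes, every other block
column has two distinct non-zero entries" the candidate space `K(xs)` has `≤ 64` elements and contains the frame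
vectors of block `0`), generalised in two directions needed at a general closed pair `(S, U)`:

* the distinguished block is any `q₀ : Fin k` (the other blocks are `q₀.succAbove i`, `i : Fin (k-1)`), because the
  good frame vectors must be chosen in a block NOT swallowed by `S`;
* the template permutation carries the linear term of the cube-orbit datum, `π = piL k ℓ = cube^k ⊕ ℓ` (invisible to
  every second difference: `Bv_piL`, `piL_pair`).

Contents (namespace `CubeBS`, `k = k' + 1`): the event `Ev q₀ r`; on it `blk_τ_eq_zero` / `blk_ξ_eq_zero` (junk and
frame directions of `K(xs)` die off block `q₀`: `probe_unit` + APN, `probe_pure` + kernel separation), `goodvec_memK`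
(`((a)_(q₀), 0) ∈ K(xs)`), `card_Kset_le` (`|K(xs)| ≤ 64`), and the product count `card_Ev`
(`|Ev| ≥ 2^(3k r)·|S1|^(k-1)`, an explicit injection built with `Fin.insertNth q₀`). `K(xs)` is W1's `CubeKS.Kset`
(the candidate space at `(0,0)`, i.e. the probe conditions alone), which contains the candidate space `KsetSU` at any
pair (verbatim shape of the registered statement, with its new-good part `goodSetSU`). Then the STATISTIC AT A
FRAME-CONFINED PAIR: if `S ⊆ Y' × 0`, `U ⊆ 0 × X''` and `((a₀)_(q₀), 0) ∉ S`, the new-good density of `K_(S,U)(xs)` is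
`≥ 1/64` on the event (`frac_ge_SU`, witness M-subspace `Y' × 0`), and W1's count and arithmetic give
`goodMass ≥ 2^(n r)/(n+2)⁸` at `r = ⌊log₂ k⌋ + 2` (`sum_bound_SU`).

References: C. Carlet, *Boolean Functions for Cryptography and Coding Theory*, CUP 2021, Prop. 54 [Carlet2020];
K. Nyberg, EUROCRYPT '93 (the cube is APN) [Nyberg1994]. -/

noncomputable section

set_option linter.dupNamespace false -- D-0017: single-problem summit ⇒ `QuantumAdvantage.QuantumAdvantage` by design

namespace Summit.QuantumAdvantage.QuantumAdvantage.Theorems.SignedExactCubicForrelationNotPrBPP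

open Finset
open Literature.Computability.Complexity Literature.Computability.QuantumComplexity
open Literature.Computability.QuantumComplexity.BuzetChailloux (bxor zeroVec bxor_self bxor_comm
  bxor_zeroVec zeroVec_bxor bxor_bxor_cancel_left)
open PolarGeometry (bdot_comm bdot_bxor_left bdot_bxor_right bxor_bxor_assoc bxor_bxor_swap exists_append
  bxor_append xor_frame_eq)
open CubeKS

namespace CubeBS

section Template

variable {k' : ℕ} {ℓ : Fin ((k' + 1) * 3) → Bool} {h : (Fin ((k' + 1) * 3) → Bool) → Bool}
  {b : (Fin ((k' + 1) * 3 + (k' + 1) * 3) → Bool) → Bool}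

/-- The event on probe tuples with distinguished block `q₀`: block `q₀` of every `x''_j` vanishes, every other
block column lies in `S1`. [folklore] -/
def Ev (q₀ : Fin (k' + 1)) (r : ℕ) : Finset (Fin r → Fin ((k' + 1) * 3 + (k' + 1) * 3) → Bool) :=
  univ.filter fun xs => (∀ j, blk (τ (xs j)) q₀ = zeroVec) ∧
    ∀ i : Fin k', (fun j => blk (τ (xs j)) (q₀.succAbove i)) ∈ S1 r

/-- Membership in `Ev`. [folklore] -/
theorem mem_Ev {q₀ : Fin (k' + 1)} {r : ℕ} {xs : Fin r → Fin ((k' + 1) * 3 + (k' + 1) * 3) → Bool} :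
    xs ∈ Ev q₀ r ↔ (∀ j, blk (τ (xs j)) q₀ = zeroVec) ∧
      ∀ i : Fin k', (fun j => blk (τ (xs j)) (q₀.succAbove i)) ∈ S1 r := by
  unfold Ev; rw [Finset.mem_filter]; exact ⟨fun h => h.2, fun h => ⟨Finset.mem_univ _, h⟩⟩

/-- **Junk directions die off block `q₀`**: on the event, `v ∈ K(xs)` has `v''` supported in block `q₀`
(unit-frame test `probe_unit` + APN in a block whose column has two distinct non-zero entries). [cite: Nyberg1994] -/
theorem blk_τ_eq_zero
    (hb : ∀ y' y'' : Fin ((k' + 1) * 3) → Bool, b (Fin.append y' y'') =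
      ((Finset.univ.filter fun i => y' i && piL (k' + 1) ℓ y'' i).card.bodd ^^ h y''))
    {q₀ : Fin (k' + 1)} {r : ℕ} {xs : Fin r → Fin ((k' + 1) * 3 + (k' + 1) * 3) → Bool} (hE : xs ∈ Ev q₀ r)
    {v : Fin ((k' + 1) * 3 + (k' + 1) * 3) → Bool} (hv : v ∈ Kset b xs) (i : Fin k') :
    blk (τ v) (q₀.succAbove i) = zeroVec := by
  obtain ⟨v', v'', rfl⟩ := exists_append v
  rw [τ_append]
  obtain ⟨j, j', hj, hj', hjj'⟩ := mem_S1.1 ((mem_Ev.1 hE).2 i)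
  have key : ∀ i', Bc (blk (τ (xs i')) (q₀.succAbove i)) (blk v'' (q₀.succAbove i)) = zeroVec := by
    intro i'
    obtain ⟨x', x'', hx⟩ := exists_append (xs i')
    have hK := (memK_iff.1 hv) i'
    rw [← hx] at hK ⊢
    rw [τ_append]
    have hBv : Bv (piL (k' + 1) ℓ) x'' v'' = zeroVec := by
      refine eq_zeroVec_of_bdot _ fun u' => ?_
      have h1 := hK (Fin.append u' zeroVec) zeroVec
      unfold Dd at h1
      simp only [zeroVec_bxor] at h1
      rwa [probe_unit hb x' x'' v' v'' u'] at h1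
    have := congrArg (fun w => blk w (q₀.succAbove i)) hBv
    simpa only [blk_Bv_piL, blk_zeroVec] using this
  rcases apn hj (key j) with h0 | h1
  · exact h0
  · rcases apn hj' (key j') with h0' | h1'
    · exact h0'
    · exact absurd (h1.symm.trans h1') hjj'

/-- **Frame directions die off block `q₀`**: on the event, `(v', 0) ∈ K(xs)` has `v'` supported in block `q₀`
(pure-`y''` test `probe_pure` + separation `sep`). [folklore] -/
theorem blk_ξ_eq_zero
    (hb : ∀ y' y'' : Fin ((k' + 1) * 3) → Bool, b (Fin.append y' y'') =
      ((Finset.univ.filter fun i => y' i && piL (k' + 1) ℓ y'' i).card.bodd ^^ h y''))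
    {q₀ : Fin (k' + 1)} {r : ℕ} {xs : Fin r → Fin ((k' + 1) * 3 + (k' + 1) * 3) → Bool} (hE : xs ∈ Ev q₀ r)
    {v' : Fin ((k' + 1) * 3) → Bool} (hv : Fin.append v' zeroVec ∈ Kset b xs) (i : Fin k') :
    blk v' (q₀.succAbove i) = zeroVec := by
  obtain ⟨j, j', hj, hj', hjj'⟩ := mem_S1.1 ((mem_Ev.1 hE).2 i)
  have key : ∀ i' w, bd3 (blk v' (q₀.succAbove i)) (Bc (blk (τ (xs i')) (q₀.succAbove i)) w) = false := by
    intro i' w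
    obtain ⟨x', x'', hx⟩ := exists_append (xs i')
    have hK := (memK_iff.1 hv) i'
    rw [← hx] at hK ⊢
    rw [τ_append]
    have h1 := hK (Fin.append zeroVec (embed (q₀.succAbove i) w)) zeroVec
    unfold Dd at h1
    simp only [zeroVec_bxor] at h1
    rwa [probe_pure hb x' x'' v' (embed (q₀.succAbove i) w), Bv_piL, Bv_embed, bdot_embed_right] at h1
  exact sep hj hj' hjj' (key j) (key j')

/-- **The good vectors**: `((a)_(q₀), 0) ∈ K(xs)` whenever block `q₀` of every `x''_j` vanishes
(`D_(x_j) D_((a)_(q₀),0) b ≡ 0` by `d2_frame`). [cite: Carlet2020, Prop. 54] -/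
theorem goodvec_memK
    (hb : ∀ y' y'' : Fin ((k' + 1) * 3) → Bool, b (Fin.append y' y'') =
      ((Finset.univ.filter fun i => y' i && piL (k' + 1) ℓ y'' i).card.bodd ^^ h y''))
    {q₀ : Fin (k' + 1)} {r : ℕ} {xs : Fin r → Fin ((k' + 1) * 3 + (k' + 1) * 3) → Bool}
    (hE0 : ∀ j, blk (τ (xs j)) q₀ = zeroVec) (a : Fin 3 → Bool) :
    Fin.append (embed q₀ a) zeroVec ∈ Kset b xs := by
  refine memK_iff.2 fun j y z => ?_
  obtain ⟨x', x'', hx⟩ := exists_append (xs j)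
  have hx0 : blk x'' q₀ = zeroVec := by rw [← hE0 j, ← hx, τ_append]
  have hD : ∀ z, Dd b (xs j) (Fin.append (embed q₀ a) zeroVec) z = false := by
    intro z
    obtain ⟨z', z'', rfl⟩ := exists_append z
    rw [← hx]
    unfold Dd
    rw [d2_frame hb x' x'' (embed q₀ a) z' z'', piL_pair, bdot_embed_left, blk_bxor, blk_cubeP, blk_cubeP, blk_bxor,
      hx0, bxor_zeroVec, bxor_self]
    simp [bd3, zeroVec]
  rw [hD, hD]; rfl

/-- A frame vector `((a)_(q₀), 0)` with `a ≠ 0` is non-zero. [folklore] -/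
theorem framevec_ne_zero (q₀ : Fin (k' + 1)) {a : Fin 3 → Bool} (ha : a ≠ zeroVec) :
    (Fin.append (embed q₀ a) zeroVec : Fin ((k' + 1) * 3 + (k' + 1) * 3) → Bool) ≠ zeroVec := by
  intro hz
  apply ha
  have h1 : embed q₀ a = zeroVec := by
    have := congrArg ξ hz
    rwa [ξ_append] at this
  have h2 := congrArg (fun w => blk w q₀) h1
  simpa only [blk_embed_self, blk_zeroVec] using h2

/-- **The candidate space is small on the event**: `|K(xs)| ≤ 64` (the `y''`-projection of `K(xs)` has `≤ 8`
values by `blk_τ_eq_zero`, each fibre is a translate of `K(xs) ∩ (Y' ⊕ 0)`, of size `≤ 8` by `blk_ξ_eq_zero`;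
`K(xs)` is `⊕`-closed). [folklore] -/
theorem card_Kset_le
    (hb : ∀ y' y'' : Fin ((k' + 1) * 3) → Bool, b (Fin.append y' y'') =
      ((Finset.univ.filter fun i => y' i && piL (k' + 1) ℓ y'' i).card.bodd ^^ h y''))
    {q₀ : Fin (k' + 1)} {r : ℕ} {xs : Fin r → Fin ((k' + 1) * 3 + (k' + 1) * 3) → Bool} (hE : xs ∈ Ev q₀ r) :
    (Kset b xs).card ≤ 64 := by
  classical
  have hblk : ∀ (w : Fin ((k' + 1) * 3) → Bool), (∀ i : Fin k', blk w (q₀.succAbove i) = zeroVec) →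
      w = embed q₀ (blk w q₀) := by
    intro w hw
    refine eq_of_blk_eq fun q => ?_
    rw [blk_embed]
    by_cases hq : q = q₀
    · rw [if_pos hq, hq]
    · obtain ⟨i, rfl⟩ := Fin.exists_succAbove_eq hq
      rw [if_neg (Fin.succAbove_ne q₀ i), hw i]
  have himg : ((Kset b xs).image τ).card ≤ 8 := by
    have hsub : (Kset b xs).image τ ⊆
        (univ : Finset (Fin 3 → Bool)).image fun c => (embed q₀ c : Fin ((k' + 1) * 3) → Bool) := by
      intro w hw
      obtain ⟨v, hv, rfl⟩ := Finset.mem_image.1 hw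
      exact Finset.mem_image.2 ⟨blk (τ v) q₀, Finset.mem_univ _, (hblk (τ v) (blk_τ_eq_zero hb hE hv)).symm⟩
    calc ((Kset b xs).image τ).card ≤ _ := Finset.card_le_card hsub
      _ ≤ (univ : Finset (Fin 3 → Bool)).card := Finset.card_image_le
      _ = 8 := card_block
  have hfib : ∀ w ∈ (Kset b xs).image τ, ((Kset b xs).filter fun v => τ v = w).card ≤ 8 := by
    intro w hw
    obtain ⟨v₀, hv₀, rfl⟩ := Finset.mem_image.1 hw
    have hsub : ((Kset b xs).filter fun v => τ v = τ v₀) ⊆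
        (univ : Finset (Fin 3 → Bool)).image fun c => bxor v₀ (Fin.append (embed q₀ c) zeroVec) := by
      intro v hv
      obtain ⟨hvK, hτv⟩ := Finset.mem_filter.1 hv
      have hu : bxor v₀ v ∈ Kset b xs := bxor_memK hv₀ hvK
      have hτu : τ (bxor v₀ v) = zeroVec := by rw [τ_bxor, hτv, bxor_self]
      have hu' : bxor v₀ v = Fin.append (ξ (bxor v₀ v)) zeroVec := by
        rw [← hτu]; exact (append_ξ_τ _).symm
      rw [hu'] at hu
      have hξ : ξ (bxor v₀ v) = embed q₀ (blk (ξ (bxor v₀ v)) q₀) := hblk _ (blk_ξ_eq_zero hb hE hu)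
      refine Finset.mem_image.2 ⟨blk (ξ (bxor v₀ v)) q₀, Finset.mem_univ _, ?_⟩
      rw [← hξ, ← hu', bxor_bxor_cancel_left]
    calc _ ≤ _ := Finset.card_le_card hsub
      _ ≤ (univ : Finset (Fin 3 → Bool)).card := Finset.card_image_le
      _ = 8 := card_block
  calc (Kset b xs).card = ∑ w ∈ (Kset b xs).image τ, ((Kset b xs).filter fun v => τ v = w).card :=
        Finset.card_eq_sum_card_image τ _
    _ ≤ ∑ _w ∈ (Kset b xs).image τ, 8 := Finset.sum_le_sum hfib
    _ = ((Kset b xs).image τ).card * 8 := by rw [Finset.sum_const, smul_eq_mul]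
    _ ≤ 8 * 8 := by omega

end Template

/-! ### Counting the event -/

/-- **The event is large**: `|Ev| ≥ 2^(3k·r) · |S1|^(k-1)` — the tuples assembled from free `x'`-parts and block
columns (`0` in block `q₀`, columns of `S1` at the blocks `q₀.succAbove i`) lie in the event, injectively.
[folklore] -/
theorem card_Ev {k' : ℕ} (q₀ : Fin (k' + 1)) (r : ℕ) :
    2 ^ ((k' + 1) * 3 * r) * (S1 r).card ^ k' ≤ (Ev q₀ r).card := by
  let Φ : (Fin r → Fin ((k' + 1) * 3) → Bool) × (Fin k' → Fin r → Fin 3 → Bool) →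
      (Fin r → Fin ((k' + 1) * 3 + (k' + 1) * 3) → Bool) :=
    fun p j => Fin.append (p.1 j)
      (glue (Fin.insertNth (α := fun _ => Fin 3 → Bool) q₀ zeroVec fun i => p.2 i j))
  have hτΦ : ∀ p j, τ (Φ p j) = glue (Fin.insertNth (α := fun _ => Fin 3 → Bool) q₀ zeroVec fun i => p.2 i j) :=
    fun p j => τ_append _ _
  have hξΦ : ∀ p j, ξ (Φ p j) = p.1 j := fun p j => ξ_append _ _
  have hcard : ((univ : Finset (Fin r → Fin ((k' + 1) * 3) → Bool)) ×ˢ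
      Fintype.piFinset (fun _ : Fin k' => S1 r)).card = 2 ^ ((k' + 1) * 3 * r) * (S1 r).card ^ k' := by
    rw [Finset.card_product, Finset.card_univ, Fintype.card_piFinset_const, Fintype.card_fun, Fintype.card_fun,
      Fintype.card_bool, Fintype.card_fin, Fintype.card_fin, ← pow_mul]
  rw [← hcard]
  refine Finset.card_le_card_of_injOn Φ (fun p hp => ?_) (fun p₁ _ p₂ _ hp => ?_)
  · have hp2 : ∀ i, p.2 i ∈ S1 r := Fintype.mem_piFinset.1 (Finset.mem_product.1 (Finset.mem_coe.1 hp)).2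
    refine Finset.mem_coe.2 (mem_Ev.2 ⟨fun j => ?_, fun i => ?_⟩)
    · rw [hτΦ, blk_glue, Fin.insertNth_apply_same]
    · have e : (fun j => blk (τ (Φ p j)) (q₀.succAbove i)) = p.2 i := by
        funext j; rw [hτΦ, blk_glue, Fin.insertNth_apply_succAbove]
      rw [e]; exact hp2 i
  · have hj : ∀ j, Φ p₁ j = Φ p₂ j := fun j => congrFun hp j
    refine Prod.ext (funext fun j => ?_) (funext fun i => funext fun j => ?_)
    · rw [← hξΦ p₁ j, ← hξΦ p₂ j, hj j]
    · have h2 := congrArg (fun x => blk (τ x) (q₀.succAbove i)) (hj j)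
      simpa only [hτΦ, blk_glue, Fin.insertNth_apply_succAbove] using h2

/-! ### The candidate space and the good set at a pair `(S, U)` (verbatim shape of the registered statement) -/

section KsetSU

variable {n : ℕ}

/-- The candidate space `K_(S,U)(xs) = Z_b(S) ∩ U^⊥ ∩ ⋂ⱼ rad B_(x_j)` of the registered statement (verbatim shape).
[folklore] -/
def KsetSU (b : (Fin n → Bool) → Bool) (S U : Finset (Fin n → Bool)) {r : ℕ} (xs : Fin r → Fin n → Bool) :
    Finset (Fin n → Bool) :=
  Finset.univ.filter fun (v : Fin n → Bool) =>
    (∀ s ∈ S, ∀ x, (b x ^^ b (bxor x s) ^^ b (bxor x v) ^^ b (bxor x (bxor s v))) = false) ∧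
    (∀ u ∈ U, ((Finset.univ.filter fun i => u i && v i).card).bodd = false) ∧
    ∀ j, (∀ y z : Fin n → Bool, ((b z ^^ b (bxor z (xs j)) ^^ b (bxor z v) ^^ b (bxor z (bxor (xs j) v))) ^^
      (b (bxor z y) ^^ b (bxor (bxor z y) (xs j)) ^^ b (bxor (bxor z y) v) ^^ b (bxor (bxor z y) (bxor (xs j) v)))) = false)

/-- The new-good part of `K_(S,U)(xs)` of the registered statement (classical filter, verbatim shape). [folklore] -/
def goodSetSU (b : (Fin n → Bool) → Bool) (S U : Finset (Fin n → Bool)) {r : ℕ} (xs : Fin r → Fin n → Bool) :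
    Finset (Fin n → Bool) :=
  @Finset.filter (Fin n → Bool) (fun v => v ∉ S ∧
    (∃ V : Finset (Fin n → Bool), ((zeroVec ∈ V ∧ ∀ x ∈ V, ∀ y ∈ V, bxor x y ∈ V) ∧
      (((V).card : ℝ) ^ 2 = (2 : ℝ) ^ n) ∧
      ∀ u ∈ V, ∀ v ∈ V, ∀ x, (b x ^^ b (bxor x u) ^^ b (bxor x v) ^^ b (bxor x (bxor u v))) = false) ∧
      S ⊆ V ∧ v ∈ V ∧
      (∀ s ∈ V, ∀ u ∈ U, ((Finset.univ.filter fun i => s i && u i).card).bodd = false)))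
    (Classical.decPred _) (KsetSU b S U xs)

/-- `K_(S,U)(xs) ⊆ K_(0,0)(xs)` (the probe conditions alone). [folklore] -/
theorem KsetSU_subset (b : (Fin n → Bool) → Bool) (S U : Finset (Fin n → Bool)) {r : ℕ}
    (xs : Fin r → Fin n → Bool) : KsetSU b S U xs ⊆ Kset b xs :=
  fun _ hv => memK_iff.2 (Finset.mem_filter.1 hv).2.2.2

end KsetSU

/-! ### The statistic on the event -/

section Template

variable {k' : ℕ} {ℓ : Fin ((k' + 1) * 3) → Bool} {h : (Fin ((k' + 1) * 3) → Bool) → Bool}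
  {b : (Fin ((k' + 1) * 3 + (k' + 1) * 3) → Bool) → Bool}

/-- **New-good density `≥ 1/64` on the event, at a frame-confined pair.** If `S ⊆ Y' × 0`, `U ⊆ 0 × X''` and the
frame vector `((a₀)_(q₀), 0)` is not in `S`, then on the event with distinguished block `q₀` it is a new good vector
of `K_(S,U)(xs)` (witness: the M-subspace `Y' × 0`), and `|K_(S,U)(xs)| ≤ |K_(0,0)(xs)| ≤ 64`.
[cite: Carlet2020, Prop. 54] -/
theorem frac_ge_SU
    (hb : ∀ y' y'' : Fin ((k' + 1) * 3) → Bool, b (Fin.append y' y'') =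
      ((Finset.univ.filter fun i => y' i && piL (k' + 1) ℓ y'' i).card.bodd ^^ h y''))
    {q₀ : Fin (k' + 1)} {r : ℕ} {xs : Fin r → Fin ((k' + 1) * 3 + (k' + 1) * 3) → Bool} (hE : xs ∈ Ev q₀ r)
    {S U : Finset (Fin ((k' + 1) * 3 + (k' + 1) * 3) → Bool)}
    (hSfr : ∀ s ∈ S, τ s = zeroVec) (hUfr : ∀ u ∈ U, ξ u = zeroVec)
    {a₀ : Fin 3 → Bool} (ha₀ : Fin.append (embed q₀ a₀) zeroVec ∉ S) :
    (1 : ℝ) / 64 ≤ ((goodSetSU b S U xs).card : ℝ) / ((KsetSU b S U xs).card : ℝ) := by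
  classical
  have hSeq : ∀ s ∈ S, Fin.append (ξ s) zeroVec = s := fun s hs => by
    have e := append_ξ_τ s
    rwa [hSfr s hs] at e
  have hUeq : ∀ u ∈ U, Fin.append zeroVec (τ u) = u := fun u hu => by
    have e := append_ξ_τ u
    rwa [hUfr u hu] at e
  -- the good vector lies in the candidate space at `(S, U)`
  have hvK : Fin.append (embed q₀ a₀) zeroVec ∈ KsetSU b S U xs := by
    refine Finset.mem_filter.2 ⟨Finset.mem_univ _, ?_, ?_, ?_⟩
    · intro s hs x
      obtain ⟨x', x'', rfl⟩ := exists_append x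
      rw [← hSeq s hs]
      exact d2_frame_frame hb (ξ s) (embed q₀ a₀) x' x''
    · intro u hu
      rw [← hUeq u hu, NoTrap.bdot_zeroVec_append]
      simp only [Fin.append_right]
      exact NoTrap.bdot_zeroVec (τ u)
    · exact memK_iff.1 (goodvec_memK hb (mem_Ev.1 hE).1 a₀)
  -- it is new and good, witnessed by the frame `Y' × 0`
  have hvG : Fin.append (embed q₀ a₀) zeroVec ∈ goodSetSU b S U xs := by
    set V : Finset (Fin ((k' + 1) * 3 + (k' + 1) * 3) → Bool) :=
      (univ : Finset (Fin ((k' + 1) * 3) → Bool)).image fun a => Fin.append a zeroVec with hVdef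
    have h0V : zeroVec ∈ V := Finset.mem_image.2 ⟨zeroVec, Finset.mem_univ _, append_zeroVec⟩
    have haddV : ∀ x ∈ V, ∀ y ∈ V, bxor x y ∈ V := by
      intro x hx y hy
      obtain ⟨a, -, rfl⟩ := Finset.mem_image.1 hx
      obtain ⟨c, -, rfl⟩ := Finset.mem_image.1 hy
      exact Finset.mem_image.2 ⟨bxor a c, Finset.mem_univ _, by rw [bxor_append, bxor_zeroVec]⟩
    have hcardV : ((V.card : ℕ) : ℝ) ^ 2 = (2 : ℝ) ^ ((k' + 1) * 3 + (k' + 1) * 3) := by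
      have hc : V.card = 2 ^ ((k' + 1) * 3) := by
        rw [hVdef, Finset.card_image_of_injective _ append_zero_injective, Finset.card_univ, Fintype.card_fun,
          Fintype.card_bool, Fintype.card_fin]
      rw [hc, Nat.cast_pow, Nat.cast_ofNat, ← pow_mul, pow_right_inj₀ (by norm_num) (by norm_num)]
      ring
    have hflatV : ∀ u ∈ V, ∀ v ∈ V, ∀ x, (b x ^^ b (bxor x u) ^^ b (bxor x v) ^^ b (bxor x (bxor u v))) = false := by
      intro u hu v hv x
      obtain ⟨a, -, rfl⟩ := Finset.mem_image.1 hu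
      obtain ⟨c, -, rfl⟩ := Finset.mem_image.1 hv
      obtain ⟨x', x'', rfl⟩ := exists_append x
      exact d2_frame_frame hb a c x' x''
    have hSV : S ⊆ V := fun s hs => Finset.mem_image.2 ⟨ξ s, Finset.mem_univ _, hSeq s hs⟩
    have hmemV : Fin.append (embed q₀ a₀) zeroVec ∈ V := Finset.mem_image.2 ⟨_, Finset.mem_univ _, rfl⟩
    have horth : ∀ s ∈ V, ∀ u ∈ U, ((Finset.univ.filter fun i => s i && u i).card).bodd = false := by
      intro s hs u hu
      obtain ⟨a, -, rfl⟩ := Finset.mem_image.1 hs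
      rw [NoTrap.bdot_append_zeroVec]
      show (univ.filter fun i => a i && ξ u i).card.bodd = false
      rw [hUfr u hu]
      exact NoTrap.bdot_zeroVec a
    unfold goodSetSU
    refine (@Finset.mem_filter _ _ (Classical.decPred _) _ _).2 ⟨hvK, ha₀, ?_⟩
    exact ⟨V, ⟨⟨h0V, haddV⟩, hcardV, hflatV⟩, hSV, hmemV, horth⟩
  have h1 : (1 : ℝ) ≤ (goodSetSU b S U xs).card := by exact_mod_cast Finset.card_pos.2 ⟨_, hvG⟩
  have h2 : ((KsetSU b S U xs).card : ℝ) ≤ 64 := by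
    exact_mod_cast (Finset.card_le_card (KsetSU_subset b S U xs)).trans (card_Kset_le hb hE)
  have h3 : (0 : ℝ) < (KsetSU b S U xs).card := by exact_mod_cast Finset.card_pos.2 ⟨_, hvK⟩
  calc (1 : ℝ) / 64 ≤ 1 / (KsetSU b S U xs).card := one_div_le_one_div_of_le h3 h2
    _ ≤ _ := div_le_div_of_nonneg_right h1 h3.le

end Template

/-- **The kernel statistics at a frame-confined pair, assembled**: for the template `b = y'·piL(y'') ⊕ h(y'')`,
`S ⊆ Y' × 0`, `U ⊆ 0 × X''`, a block `q₀` with `((a₀)_(q₀), 0) ∉ S` and `r = ⌊log₂ k⌋ + 2` probes,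
`goodMass ≥ |Ev_(q₀)|/64 ≥ 2^(3k r)|S1|^(k-1)/64 ≥ 2^(n r)/(n+2)⁸` (W1's count and arithmetic). [folklore] -/
theorem sum_bound_SU (k : ℕ) (hk : 0 < k) (ℓ : Fin (k * 3) → Bool) (h : (Fin (k * 3) → Bool) → Bool)
    (b : (Fin (k * 3 + k * 3) → Bool) → Bool)
    (hb : ∀ y' y'' : Fin (k * 3) → Bool, b (Fin.append y' y'') =
      ((Finset.univ.filter fun i => y' i && piL k ℓ y'' i).card.bodd ^^ h y''))
    (S U : Finset (Fin (k * 3 + k * 3) → Bool))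
    (hSfr : ∀ s ∈ S, τ s = zeroVec) (hUfr : ∀ u ∈ U, ξ u = zeroVec)
    (q₀ : Fin k) (a₀ : Fin 3 → Bool) (ha₀ : Fin.append (embed q₀ a₀) zeroVec ∉ S) :
    (2 : ℝ) ^ ((k * 3 + k * 3) * (Nat.log 2 k + 2)) / ((k * 3 + k * 3 + 2 : ℝ) ^ 8) ≤
      ∑ xs : Fin (Nat.log 2 k + 2) → (Fin (k * 3 + k * 3) → Bool),
        ((goodSetSU b S U xs).card : ℝ) / ((KsetSU b S U xs).card : ℝ) := by
  obtain ⟨k', rfl⟩ : ∃ k', k = k' + 1 := ⟨k - 1, by omega⟩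
  have hS1 : (8 : ℝ) ^ (Nat.log 2 (k' + 1) + 2) - 8 * 2 ^ (Nat.log 2 (k' + 1) + 2) ≤
      (S1 ((Nat.log 2 (k' + 1) + 2))).card := by
    have h' : ((8 ^ (Nat.log 2 (k' + 1) + 2) : ℕ) : ℝ) ≤
        (((S1 ((Nat.log 2 (k' + 1) + 2))).card + 8 * 2 ^ (Nat.log 2 (k' + 1) + 2) : ℕ) : ℝ) := by
      exact_mod_cast card_S1 ((Nat.log 2 (k' + 1) + 2))
    push_cast at h'
    linarith
  calc _ ≤ (2 : ℝ) ^ ((k' + 1) * 3 * (Nat.log 2 (k' + 1) + 2)) *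
        ((S1 ((Nat.log 2 (k' + 1) + 2))).card : ℝ) ^ k' / 64 := arith k' hS1
    _ ≤ ((Ev q₀ ((Nat.log 2 (k' + 1) + 2))).card : ℝ) / 64 := by
        gcongr
        exact_mod_cast card_Ev q₀ ((Nat.log 2 (k' + 1) + 2))
    _ = ∑ _xs ∈ Ev q₀ ((Nat.log 2 (k' + 1) + 2)), (1 : ℝ) / 64 := by rw [Finset.sum_const, nsmul_eq_mul]; ring
    _ ≤ ∑ xs ∈ Ev q₀ ((Nat.log 2 (k' + 1) + 2)), ((goodSetSU b S U xs).card : ℝ) / ((KsetSU b S U xs).card : ℝ) :=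
        Finset.sum_le_sum fun xs hxs => frac_ge_SU hb hxs hSfr hUfr ha₀
    _ ≤ _ := Finset.sum_le_sum_of_subset_of_nonneg (Finset.subset_univ _) fun xs _ _ => by positivity

end CubeBS

end Summit.QuantumAdvantage.QuantumAdvantage.Theorems.SignedExactCubicForrelationNotPrBPP
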